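import Mathlib
import Summits.PneNP.PneNP.Theorems.CnfIdealGenLengthRankDefectRepresentationsSimReduction

/-!
# Crux `RankDefectRepresentations` (stmt-PneNP-18923), line `rank-dehn-ladder`, RESHAPE 17:
# Σ-SIM for three coordinates (`stub_sigmaSimThree`, brief g17 §W22)

The SIM gluing problem (`…SimReduction.SimBound`): rows `ι` and columns `ι'` carry cube colours
`row x, col y : Fin n → Bool`, `cut k M` keeps the entries of `M` whose row and column colours differ at `k`,
the data `y_k` are supported on their cuts (`cut k (y k) = y k`), and the pairwise DEFECT of `(k,l)` is
`e_kl := cut k (cut l (y_k − y_l))`, of rank `t_kl`.  In the SUM currency of RESHAPE 17 one asks for ONE matrix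
`z` whose total error `Σ_k rank (cut k (z − y_k))` is bounded by (a constant times) the total defect.

This file proves the registered worker stub `stub_sigmaSimThree`: for `n = 3` the SEQUENTIAL scheme
`z := y₀ + EQ₀ y₁ + EQ₀ EQ₁ y₂` (`EQ_k M := M − cut k M` keeps the entries whose colours AGREE at `k`) has
errors `cut 0 (z − y₀) = 0`, `cut 1 (z − y₁) = e₀₁`, `cut 2 (z − y₂) = e₀₂ + EQ₀ e₁₂`, and the COCYCLE MASK
identity `cut 0 e₁₂ = cut 1 e₀₂ − cut 2 e₀₁` (split `y₁ − y₂ = (y₀ − y₂) − (y₀ − y₁)`) bounds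
`rank (cut 0 e₁₂) ≤ 2 t₀₂ + 2 t₀₁` (`rank_cut_le`), so the total error is at most
`0 + t₀₁ + (t₀₂ + t₁₂ + 2 t₀₂ + 2 t₀₁) = 3 t₀₁ + 3 t₀₂ + t₁₂` — exactly the registered bound.
All matrix identities are checked entrywise (eight colour cases).
HONEST FRAMING: elementary linear algebra calibrating the Σ-currency; P ≠ NP is not moved; F-N2 is a FRONTIER
formal rung.
-/

set_option linter.dupNamespace false -- `Summit.PneNP.PneNP.…`: summit = sub-problem name (D-0017)

namespace Summit.PneNP.PneNP.Theorems.CnfIdealGenLengthRankDefectRepresentationsSigmaSimThree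

open Matrix
open Summit.PneNP.PneNP.Theorems.CnfIdealGenLengthRankDefectRepresentationsMergeLowerBound (rank_add_le' rank_sub_le')
open Summit.PneNP.PneNP.Theorems.CnfIdealGenLengthRankDefectRepresentationsSimReduction (cut rank_cut_le)

/-- **Σ-SIM for three coordinates** (registered stub `stub_sigmaSimThree` of line `rank-dehn-ladder`, RESHAPE 17):
the sequential scheme `z := y₀ + EQ₀ y₁ + EQ₀ EQ₁ y₂` (`EQ_k M := M − cut k M`) glues three cut-supported data with
total error `Σ_k rank (cut k (z − y_k)) ≤ 3 t₀₁ + 3 t₀₂ + t₁₂`, where `t_kl := rank (cut k (cut l (y_k − y_l)))`. -/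
theorem stub_sigmaSimThree :
    ∀ (K : Type) [Field K] (ι ι' : Type) [Fintype ι] [Fintype ι'] [DecidableEq ι] [DecidableEq ι']
      (row : ι → Fin 3 → Bool) (col : ι' → Fin 3 → Bool) (y : Fin 3 → Matrix ι ι' K),
      (∀ k, Summit.PneNP.PneNP.Theorems.CnfIdealGenLengthRankDefectRepresentationsSimReduction.cut row col k (y k) = y k) →
      ∃ z : Matrix ι ι' K,
        ∑ k, (Summit.PneNP.PneNP.Theorems.CnfIdealGenLengthRankDefectRepresentationsSimReduction.cut row col k (z - y k)).rank ≤
          3 * (Summit.PneNP.PneNP.Theorems.CnfIdealGenLengthRankDefectRepresentationsSimReduction.cut row col 0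
                (Summit.PneNP.PneNP.Theorems.CnfIdealGenLengthRankDefectRepresentationsSimReduction.cut row col 1 (y 0 - y 1))).rank +
          3 * (Summit.PneNP.PneNP.Theorems.CnfIdealGenLengthRankDefectRepresentationsSimReduction.cut row col 0
                (Summit.PneNP.PneNP.Theorems.CnfIdealGenLengthRankDefectRepresentationsSimReduction.cut row col 2 (y 0 - y 2))).rank +
          (Summit.PneNP.PneNP.Theorems.CnfIdealGenLengthRankDefectRepresentationsSimReduction.cut row col 1
                (Summit.PneNP.PneNP.Theorems.CnfIdealGenLengthRankDefectRepresentationsSimReduction.cut row col 2 (y 1 - y 2))).rank := by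
  intro K _ ι ι' _ _ _ _ row col y hsupp
  -- the data vanish where the colours agree
  have hvan : ∀ k x y', row x k = col y' k → y k x y' = 0 := by
    intro k x y' h
    simpa [cut, h] using (congrFun (congrFun (hsupp k) x) y').symm
  -- the sequential glue `z := y₀ + EQ₀ y₁ + EQ₀ EQ₁ y₂`, `EQ_k M := M − cut k M`
  refine ⟨y 0 + (y 1 - cut row col 0 (y 1)) +
      ((y 2 - cut row col 1 (y 2)) - cut row col 0 (y 2 - cut row col 1 (y 2))), ?_⟩
  set e01 := cut row col 0 (cut row col 1 (y 0 - y 1)) with he01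
  set e02 := cut row col 0 (cut row col 2 (y 0 - y 2)) with he02
  set e12 := cut row col 1 (cut row col 2 (y 1 - y 2)) with he12
  -- error at coordinate 0: none
  have h0 : cut row col 0 (y 0 + (y 1 - cut row col 0 (y 1)) +
      ((y 2 - cut row col 1 (y 2)) - cut row col 0 (y 2 - cut row col 1 (y 2))) - y 0) = 0 := by
    ext x y'
    by_cases a0 : row x 0 = col y' 0 <;> simp [cut, a0]
  -- error at coordinate 1: the defect `e₀₁`
  have h1 : cut row col 1 (y 0 + (y 1 - cut row col 0 (y 1)) +
      ((y 2 - cut row col 1 (y 2)) - cut row col 0 (y 2 - cut row col 1 (y 2))) - y 1) = e01 := by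
    ext x y'
    by_cases a0 : row x 0 = col y' 0 <;> by_cases a1 : row x 1 = col y' 1 <;> simp [cut, he01, a0, a1, hvan]
  -- error at coordinate 2: `e₀₂ + EQ₀ e₁₂`
  have h2 : cut row col 2 (y 0 + (y 1 - cut row col 0 (y 1)) +
      ((y 2 - cut row col 1 (y 2)) - cut row col 0 (y 2 - cut row col 1 (y 2))) - y 2) =
      e02 + e12 - cut row col 0 e12 := by
    ext x y'
    by_cases a0 : row x 0 = col y' 0 <;> by_cases a1 : row x 1 = col y' 1 <;> by_cases a2 : row x 2 = col y' 2 <;>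
      simp [cut, he02, he12, a0, a1, a2, hvan]
  -- the cocycle mask identity
  have h3 : cut row col 0 e12 = cut row col 1 e02 - cut row col 2 e01 := by
    ext x y'
    by_cases a0 : row x 0 = col y' 0 <;> by_cases a1 : row x 1 = col y' 1 <;> by_cases a2 : row x 2 = col y' 2 <;>
      simp [cut, he01, he02, he12, a0, a1, a2]
  -- ranks
  have r3 : (cut row col 0 e12).rank ≤ 2 * e02.rank + 2 * e01.rank := by
    rw [h3]
    exact (rank_sub_le' _ _).trans (Nat.add_le_add (rank_cut_le row col 1 e02) (rank_cut_le row col 2 e01))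
  have r2 : (e02 + e12 - cut row col 0 e12).rank ≤ e02.rank + e12.rank + (2 * e02.rank + 2 * e01.rank) :=
    (rank_sub_le' _ _).trans (Nat.add_le_add (rank_add_le' _ _) r3)
  rw [Fin.sum_univ_three, h0, h1, h2, Matrix.rank_zero]
  omega

end Summit.PneNP.PneNP.Theorems.CnfIdealGenLengthRankDefectRepresentationsSigmaSimThree
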